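import Summits.AtomisticToContinuum.Crystallization.Theorems.FrustratedLawDichotomyCoherentFloorAlgebra
import Summits.AtomisticToContinuum.Crystallization.Theorems.FrustratedLawDichotomyCoherentWindow
import Summits.AtomisticToContinuum.Crystallization.Theorems.FrustratedLawDichotomyFarForceColumn
import Summits.AtomisticToContinuum.Crystallization.Theorems.FrustratedLawDichotomyTransportPriceTail
import Summits.AtomisticToContinuum.Crystallization.Theorems.FrustratedLawDichotomyNashForceBalance
import Summits.AtomisticToContinuum.Crystallization.Theorems.LoopTunnelDialRangeTails

/-!
# FrustratedLawDichotomy · crux `AperiodicFrustratedLawGap` (stmt-AtomisticToContinuum-27623) — T2, PART B: THE COHERENT-WINDOW CERTIFICATE FLOOR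
# (the class-A pointwise root-energy floor, ASSEMBLED from PART A + NODE-13 + the far columns; decomp-a2c lens-5, generation 112)

Reading A′ of record: the residual crux follows from `hdef` alone (`…SignedLedgerNetDoor.aperiodicFrustratedLawGap_of_netData_and_defectDensity`),
and `hdef` is assembled from POINTWISE root-energy floors on a finite atlas of root classes (`…SignedLedger.LawLedger.ofPointwise`).  This module is
the INSTRUMENT for the bulk class A («the root's `Rc`-window is `τ`-coherent with a strained close-packed template»): it turns the finite CELL DATA
`(a, I, y, τ, Rc)` — template `a ∋ 0`, interior sites `I ⊆ a`, multipliers `y`, tolerance `τ`, window radius `Rc` — into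
`certFloor a I y τ Rc ≤ 2·rootEnergy V_LJ μ` for every rooted `7/10`-hard-core `μ` coherent with `a` whose interior atoms are in force equilibrium,
which the crux's NASH clause (e) supplies (`…NashForceBalance.hasSum_force_of_nash`).  The bookkeeping (`windowSum_ge`, slots) is PART A.

* `norm_sum_template_force_le` ★ — THE FORCE-BALANCE SPLIT on a coherent window: equilibrium at `q_x` ⟹ the in-window force
  `‖Σ_{x'∈a∖x} F(q_x − q_{x'})‖ ≤ farCol (Rc − (|x| + τ)) = T0` (the `HasSum` split of `…TransportPriceFiniteForce.truncated_force_le` with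
  `…FarForceColumn.sum_norm_force_le_sevenTenths_of_far_from_root`; NODE-13 `…CoherentWindow` identifies the window atoms with `atomOf '' a`).
* `setLIntegral_enorm_lennardJones_compl_le`, `abs_setIntegral_compl_lennardJones_le` — the SIGNED ENERGY TAIL `|∫_{|z|>R} V_LJ dμ| ≤ tailCol R = T♯(R)`
  (`R ≥ 1`; `…FarFieldSharp.sum_inv_pow_le_of_separated_sharp`, `k = 3`, on finite subsets; `tailCol 14 ≤ 9/5000`), replacing the crude
  `…TransportPriceTail.abs_rootEnergy_sub_truncated_le` (`0.116` at `R = 14`).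
* ★★★ `certFloor_le_two_mul_rootEnergy` (explicit, force balance as `HasSum` hypotheses) and `certFloor_le_two_mul_rootEnergy_of_nash` (under the crux's
  clauses: `IsRootedHardCore (7/10) μ`, Nash (e) VERBATIM, `μ ∈ coherentAt a τ Rc`) — **T2**, with
  `certFloor a I y τ Rc = Σ_{x∈a∖0}(φ(|x|²) − τ²·secondNeg|x| − energyRem|x| τ) − τ·Σ_{z∈a∖0}‖ψ(|z|²)z − c_z(y)‖ − Σ_{x∈I}⟪y_x, H_x⟫`
  `  − Σ_{x∈I}‖y_x‖·farCol(Rc − |x| − τ) − ½·Σ_{x∈a}Σ_{x'∈a∖x}‖Y_x − Y_{x'}‖·forceRem |x − x'| (dispB x + dispB x') − tailCol Rc` (`Y = mulExt I y`: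
  the force remainder is booked per BOND with the multiplier DIFFERENCE — the census's `Σ_b |Δy_b|·½C_b|δu_b|²` shape).

## Units (the convention sentence of record, r1751 (A) — settled formally by `certFloor_le_two_mul_rootEnergy`)

`certFloor` and EVERY column in it — the truncated template energy, the second/third-order energy debits, the NASH residual `τ·Σ_z‖ψ(|z|²)z − c_z(y)‖`
(multipliers in convention (i): first variation `T′`, FULL, per-site EUCLIDEAN norm), the host term, the far-FORCE column `Σ_{x∈I}‖y_x‖·T0(Rc − |x| − τ)`
(ONE `T0` per interior site), the force remainders and the energy tail `tailCol Rc = T♯(Rc) = S(3,Rc)/6` — are in FULL units (`Σ_n V_LJ(|q_n|) =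
2·rootEnergy`, the units of `T′`); the conclusion halves them TOGETHER into the root-energy ledger where `γ, Θ, slack, e⋆` live (`rootEnergy ≥ ½·certFloor`).
The net far-ENERGY debit in root-energy units is `½·tailCol Rc` minus the host's own (negative) tail beyond `Rc`, credited automatically by the TRUNCATED
template sum: `= debit_E(Rc) = (S(3,Rc) − H6_host(Rc))/12` of r1747 (D).

## The cell schema (docket r1745 (B)(1))

Per atlas cell: the finite rational data `(a, I, y, τ_A, Rc)` and ONE inequality `2·(Ē + γ_cell) ≤ certFloor a I y τ_A Rc` (`Ē ≥ e⋆` certified, e.g.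
`e(hcp)`), proved by evaluation / interval arithmetic over the cell's strain box — the template enters only through the finitely many numbers `|x|`,
`|x − x'|`, `⟪·,·⟫`; T2 then gives `Ē + γ_cell ≤ rootEnergy V_LJ μ` on `{μ coherent with a}`, the `floor_good` field of `LawLedger.ofPointwise`.  With
NODE-10/12's isotropic constants the `fR`/`eR` columns force a small `τ_A` (R1 fallback `1/1024`); a split radial/transverse slot filler relaxes it.

DEFS `farCol tailCol certFloor` (plain `def`s; no instance / notation); imports PART A, the tree's `…CoherentWindow` (NODE-13), `…FarForceColumn`,
`…TransportPriceTail`, `…NashForceBalance`; 0 sorry.  All `[folklore]`; nothing here closes an item.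
-/

noncomputable section

namespace Summit.AtomisticToContinuum.Crystallization.Theorems.FrustratedLawDichotomyCoherentFloor

open MeasureTheory Metric Set Filter RealInnerProductSpace
open scoped BigOperators Topology ENNReal
open Literature.MathematicalPhysics.StatisticalMechanics (lennardJones rootEnergy rootEnergy_def)
open Literature.Probability.Process (IsRootedHardCore count_restrict_singleton_ne_zero_iff)
open Summit.AtomisticToContinuum.Crystallization.Theorems.ChargedEnergyGapNegative (E3)
open Summit.AtomisticToContinuum.Crystallization.Theorems.FrustratedLawDichotomyCoherentSets (coherentAt)
open Summit.AtomisticToContinuum.Crystallization.Theorems.FrustratedLawDichotomyCoherentWindow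
open Summit.AtomisticToContinuum.Crystallization.Theorems.FrustratedLawDichotomyEnergyRemainder (inv_sq_pow_eq)
open Summit.AtomisticToContinuum.Crystallization.Theorems.FrustratedLawDichotomyFarForceColumn (sum_norm_force_le_sevenTenths
  sum_norm_force_le_sevenTenths_of_far_from_root)
open Summit.AtomisticToContinuum.Crystallization.Theorems.FrustratedLawDichotomyFarFieldSharp (sum_inv_pow_le_of_separated_sharp)
open Summit.AtomisticToContinuum.Crystallization.Theorems.FrustratedLawDichotomyTransportPriceTail (countable_of_separated
  integrable_lennardJones_of_isRootedHardCore)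
open Literature.Probability.Process.LocalConfig (finite_inter_of_separated)
open Summit.AtomisticToContinuum.Crystallization.Theorems.FrustratedLawDichotomyNashForceBalance (hasSum_force_of_nash)
open Summit.AtomisticToContinuum.Crystallization.Theorems.FrustratedLawDichotomyCoherentFloorAlgebra

/-! ## §4. The far columns: the force balance split on a coherent window, and the energy tail -/

/-- `V_LJ(r) = φ(r²)`. [folklore] -/
theorem lennardJones_eq_phiT (r : ℝ) : lennardJones r = phiT (r ^ 2) := by
  unfold lennardJones phiT
  rw [inv_sq_pow_eq, inv_sq_pow_eq]

/-- `FarForceColumn`'s sharp far FORCE column `T0(R)` of a `7/10`-separated set beyond distance `R` (`sum_norm_force_le_sevenTenths`). -/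
def farCol (R : ℝ) : ℝ :=
  6000 / 343 * R⁻¹ ^ 4 + 2880 / 49 * R⁻¹ ^ 5 + 10 / 7 * R⁻¹ ^ 6 + 2 * R⁻¹ ^ 7 +
    (2400 / 343 * R⁻¹ ^ 10 + 28800 / 539 * R⁻¹ ^ 11 + 5 / 7 * R⁻¹ ^ 12 + 2 * R⁻¹ ^ 13)

/-- `FarFieldSharp`'s sharp far ENERGY column `T♯(R)` (`= ExemptLocalSharp.tailConstSharp`, restated to keep the imports thin). -/
def tailCol (R : ℝ) : ℝ := 4000 / 1029 * R⁻¹ ^ 3 + 500 / 49 * R⁻¹ ^ 4 + 2 / 7 * R⁻¹ ^ 5 + 1 / 3 * R⁻¹ ^ 6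

/-- ★ THE FORCE-BALANCE SPLIT on a coherent window.  If the actual atom `q_x = atomOf S τ x` of the template site `x ∈ a` is in force
equilibrium (`HasSum … 0`, the conclusion of `…NashForceBalance.hasSum_force_of_nash`), then the in-window force on it — the finite sum over the
other template atoms — is at most the far column `T0(Rc − (‖x‖ + τ))`. [folklore] -/
theorem norm_sum_template_force_le {S : Set E3} {τ Rc : ℝ} {a : Finset E3}
    (hS : ∀ p ∈ S, ∀ p' ∈ S, p ≠ p' → (7 : ℝ) / 10 ≤ dist p p') (hτ : 2 * τ < 7 / 10)
    (hcoh : (Measure.count.restrict S : Measure E3) ∈ coherentAt a τ Rc)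
    (ha : ∀ x ∈ a, ∀ x' ∈ a, x ≠ x' → 2 * τ < dist x x') (hin : ∀ x ∈ a, ‖x‖ + τ ≤ Rc)
    {x : E3} (hx : x ∈ a) (hR : 7 / 20 ≤ Rc - (‖x‖ + τ))
    (hbal : HasSum (fun q : {q : E3 // (Measure.count.restrict S : Measure E3) {q} ≠ 0 ∧ q ≠ atomOf S τ x} =>
      ((dist (atomOf S τ x) (q : E3))⁻¹ ^ 8 - (dist (atomOf S τ x) (q : E3))⁻¹ ^ 14) • (atomOf S τ x - (q : E3))) 0) :
    ‖∑ x' ∈ a.erase x, ljBondForce (atomOf S τ x - atomOf S τ x')‖ ≤ farCol (Rc - (‖x‖ + τ)) := by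
  classical
  have h7 : (0 : ℝ) < 7 / 10 := by norm_num
  have hne : ∀ z ∈ a, (closedBall z τ ∩ S).Nonempty := fun z hz => nonempty_of_mem_coherentAt hcoh hz
  set p : E3 := atomOf S τ x with hp
  have hpS : p ∈ S := (atomOf_mem (hne x hx)).2
  have hpn : ‖p‖ ≤ ‖x‖ + τ := norm_atomOf_le (hne x hx)
  set T := {q : E3 // (Measure.count.restrict S : Measure E3) {q} ≠ 0 ∧ q ≠ p}
  set f : T → E3 := fun q => ((dist p (q : E3))⁻¹ ^ 8 - (dist p (q : E3))⁻¹ ^ 14) • (p - (q : E3)) with hf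
  have hmemT : ∀ q : T, (q : E3) ∈ S ∧ (q : E3) ≠ p := fun q =>
    ⟨(count_restrict_singleton_ne_zero_iff S q).mp q.2.1, q.2.2⟩
  have hdistT : ∀ q : T, (7 : ℝ) / 10 ≤ dist (q : E3) p := fun q => hS _ (hmemT q).1 p hpS (hmemT q).2
  -- the norms are summable: every finite column is at most `T0(7/10)`
  have hnorm : Summable fun q : T => ‖f q‖ := by
    refine summable_of_sum_le (fun q => norm_nonneg _) (c := farCol (7 / 10)) fun u => ?_
    have hmap : ∑ q ∈ u, ‖f q‖ =
        ∑ q ∈ u.map (Function.Embedding.subtype _), ‖((dist p q)⁻¹ ^ 8 - (dist p q)⁻¹ ^ 14) • (p - q)‖ := by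
      rw [Finset.sum_map]; rfl
    rw [hmap]
    unfold farCol
    refine sum_norm_force_le_sevenTenths _ p (by norm_num) (fun q hq q' hq' hqq' => ?_) (fun q hq => ?_)
    · obtain ⟨w, -, rfl⟩ := Finset.mem_map.mp hq
      obtain ⟨w', -, rfl⟩ := Finset.mem_map.mp hq'
      exact hS _ (hmemT w).1 _ (hmemT w').1 hqq'
    · obtain ⟨w, -, rfl⟩ := Finset.mem_map.mp hq
      exact hdistT w
  -- the window part of `T`
  have hfin : (closedBall (0 : E3) Rc ∩ S).Finite := finite_inter_of_separated h7 hS (isCompact_closedBall _ _)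
  have hnear : {q : T | (q : E3) ∈ closedBall (0 : E3) Rc}.Finite :=
    Finite.of_injOn (f := fun q : T => (q : E3)) (t := closedBall (0 : E3) Rc ∩ S) (fun q hq => ⟨hq, (hmemT q).1⟩)
      Subtype.val_injective.injOn hfin
  set s : Finset T := hnear.toFinset with hs
  have hsplit := hbal.summable.sum_add_tsum_compl (s := s)
  rw [hbal.tsum_eq] at hsplit
  have hsum_s : ∑ q ∈ s, f q = -∑' q : ↑((↑s : Set T)ᶜ), f q := eq_neg_of_add_eq_zero_left hsplit
  -- complement points lie outside the window
  have hfar : ∀ q : ↑((↑s : Set T)ᶜ), Rc ≤ dist ((q : T) : E3) (0 : E3) := fun q => by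
    have h1 : (q : T) ∉ (↑s : Set T) := q.2
    have h2 : (q : T) ∉ hnear.toFinset := h1
    rw [Finite.mem_toFinset] at h2
    have h3 : ¬ ((q : T) : E3) ∈ closedBall (0 : E3) Rc := h2
    rw [mem_closedBall, not_le] at h3
    exact h3.le
  have hnormc : Summable fun q : ↑((↑s : Set T)ᶜ) => ‖f q‖ := hnorm.subtype _
  have htail : ∑' q : ↑((↑s : Set T)ᶜ), ‖f q‖ ≤ farCol (Rc - (‖x‖ + τ)) := by
    refine hnormc.tsum_le_of_sum_le fun u => ?_
    set emb : ↑((↑s : Set T)ᶜ) ↪ E3 := ⟨fun q => ((q : T) : E3), fun q q' hqq' => Subtype.ext (Subtype.ext hqq')⟩ with hemb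
    have hmap : ∑ q ∈ u, ‖f q‖ = ∑ q ∈ u.map emb, ‖((dist p q)⁻¹ ^ 8 - (dist p q)⁻¹ ^ 14) • (p - q)‖ := by
      rw [Finset.sum_map]; rfl
    rw [hmap]
    unfold farCol
    refine sum_norm_force_le_sevenTenths_of_far_from_root _ p 0 (by rwa [dist_zero_right]) hR
      (fun q hq q' hq' hqq' => ?_) (fun q hq => ?_)
    · obtain ⟨w, -, rfl⟩ := Finset.mem_map.mp hq
      obtain ⟨w', -, rfl⟩ := Finset.mem_map.mp hq'
      exact hS _ (hmemT w).1 _ (hmemT w').1 hqq'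
    · obtain ⟨w, -, rfl⟩ := Finset.mem_map.mp hq
      exact hfar w
  -- the window part of the balance is the template sum
  have hmapS : s.map (Function.Embedding.subtype _) = (a.erase x).image (atomOf S τ) := by
    ext q
    rw [Finset.mem_map, Finset.mem_image]
    constructor
    · rintro ⟨w, hw, rfl⟩
      rw [hs, Finite.mem_toFinset] at hw
      obtain ⟨x', hx', hEq⟩ := inter_closedBall_subset_image_atomOf hS hτ hcoh ⟨(hmemT w).1, hw⟩
      refine ⟨x', Finset.mem_erase.mpr ⟨?_, hx'⟩, hEq⟩
      rintro rfl
      exact (hmemT w).2 hEq.symm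
    · rintro ⟨x', hx', hq⟩
      have hx'a := Finset.mem_of_mem_erase hx'
      have hm := atomOf_mem (hne x' hx'a)
      have hneq : atomOf S τ x' ≠ p := fun h =>
        Finset.ne_of_mem_erase hx' ((injOn_atomOf ha hne) hx'a hx h)
      refine ⟨⟨atomOf S τ x', (count_restrict_singleton_ne_zero_iff S _).mpr hm.2, hneq⟩, ?_, hq⟩
      rw [hs, Finite.mem_toFinset]
      exact mem_closedBall_zero_iff.mpr ((norm_atomOf_le (hne x' hx'a)).trans (hin x' hx'a))
  have hwin : ∑ q ∈ s, f q = ∑ x' ∈ a.erase x, ljBondForce (p - atomOf S τ x') :=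
    calc ∑ q ∈ s, f q = ∑ q ∈ s.map (Function.Embedding.subtype _), ((dist p q)⁻¹ ^ 8 - (dist p q)⁻¹ ^ 14) • (p - q) := by
          rw [Finset.sum_map]; rfl
      _ = ∑ q ∈ (a.erase x).image (atomOf S τ), ((dist p q)⁻¹ ^ 8 - (dist p q)⁻¹ ^ 14) • (p - q) := by rw [hmapS]
      _ = ∑ x' ∈ a.erase x, ((dist p (atomOf S τ x'))⁻¹ ^ 8 - (dist p (atomOf S τ x'))⁻¹ ^ 14) • (p - atomOf S τ x') :=
          Finset.sum_image fun x₁ h₁ x₂ h₂ h =>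
            (injOn_atomOf ha hne) (Finset.mem_of_mem_erase h₁) (Finset.mem_of_mem_erase h₂) h
      _ = ∑ x' ∈ a.erase x, ljBondForce (p - atomOf S τ x') := Finset.sum_congr rfl fun x' _ => force_eq_ljBondForce _ _
  rw [← hwin, hsum_s, norm_neg]
  exact (norm_tsum_le_tsum_norm hnormc).trans htail

/-- ★ THE SHARP ENERGY TAIL on a `7/10`-separated configuration: `∫⁻_{‖z‖ > R} ‖V_LJ(‖z‖)‖ₑ d(count⌊S) ≤ T♯(R)` for `R ≥ 1`
(`FarFieldSharp.sum_inv_pow_le_of_separated_sharp`, `k = 3`, on every finite subset). [folklore] -/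
theorem setLIntegral_enorm_lennardJones_compl_le {S : Set E3}
    (hS : ∀ p ∈ S, ∀ p' ∈ S, p ≠ p' → (7 : ℝ) / 10 ≤ dist p p') {R : ℝ} (hR : 1 ≤ R) :
    ∫⁻ z in (closedBall (0 : E3) R)ᶜ, ‖lennardJones ‖z‖‖ₑ ∂(Measure.count.restrict S : Measure E3) ≤ ENNReal.ofReal (tailCol R) := by
  classical
  have h7 : (0 : ℝ) < 7 / 10 := by norm_num
  have hSc : ((closedBall (0 : E3) R)ᶜ ∩ S).Countable := (countable_of_separated h7 hS).mono inter_subset_right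
  rw [Measure.restrict_restrict (measurableSet_closedBall.compl), lintegral_countable _ hSc]
  simp only [Measure.count_singleton, mul_one]
  refine ENNReal.summable.tsum_le_of_sum_le fun t => ?_
  set t' : Finset E3 := t.map (Function.Embedding.subtype _) with ht'
  have hmem : ∀ z ∈ t', R < ‖z‖ ∧ z ∈ S := fun z hz => by
    obtain ⟨w, -, rfl⟩ := Finset.mem_map.mp hz
    have hw := w.2
    simp only [mem_inter_iff, mem_compl_iff, mem_closedBall, dist_zero_right, not_le] at hw
    exact hw
  have hpt : ∀ z ∈ t', ‖lennardJones ‖z‖‖ₑ ≤ ENNReal.ofReal (1 / 6 * ‖z‖⁻¹ ^ 6) := fun z hz => by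
    rw [Real.enorm_eq_ofReal_abs]
    exact ENNReal.ofReal_le_ofReal (LoopTunnelDialRangeTails.abs_lennardJones_le_of_one_le (hR.trans (hmem z hz).1.le))
  have hsum : ∑ w ∈ t, ‖lennardJones ‖(w : E3)‖‖ₑ = ∑ z ∈ t', ‖lennardJones ‖z‖‖ₑ := by
    rw [ht', Finset.sum_map]; rfl
  rw [hsum]
  calc ∑ z ∈ t', ‖lennardJones ‖z‖‖ₑ ≤ ∑ z ∈ t', ENNReal.ofReal (1 / 6 * ‖z‖⁻¹ ^ 6) := Finset.sum_le_sum hpt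
    _ = ENNReal.ofReal (∑ z ∈ t', 1 / 6 * ‖z‖⁻¹ ^ 6) := (ENNReal.ofReal_sum_of_nonneg fun z _ => by positivity).symm
    _ ≤ ENNReal.ofReal (tailCol R) := ENNReal.ofReal_le_ofReal ?_
  have h2 := sum_inv_pow_le_of_separated_sharp t' (0 : E3) (k := 3) (R := R) (by norm_num) h7 (by linarith)
    (fun z hz z' hz' hzz' => hS z (hmem z hz).2 z' (hmem z' hz').2 hzz')
    (fun z hz => by rw [dist_zero_right]; exact (hmem z hz).1.le)
  calc ∑ z ∈ t', 1 / 6 * ‖z‖⁻¹ ^ 6 = 1 / 6 * ∑ z ∈ t', (dist z (0 : E3))⁻¹ ^ (3 + 3) := by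
        rw [Finset.mul_sum]
        exact Finset.sum_congr rfl fun z _ => by rw [dist_zero_right]
    _ ≤ 1 / 6 * (3 / ((3 : ℕ) : ℝ) * (2 / (7 / 10)) ^ 3 * R⁻¹ ^ 3 +
          6 * (((3 : ℕ) : ℝ) + 2) / (((3 : ℕ) : ℝ) + 1) * (2 / (7 / 10)) ^ 2 * R⁻¹ ^ (3 + 1) +
          3 / (((3 : ℕ) : ℝ) + 2) * (2 / (7 / 10)) * R⁻¹ ^ (3 + 2) + 2 * R⁻¹ ^ (3 + 3)) := by gcongr
    _ = tailCol R := by unfold tailCol; push_cast; ring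

/-- The signed energy tail: `|∫_{‖z‖ > R} V_LJ(‖z‖) d(count⌊S)| ≤ T♯(R)` (`R ≥ 1`, `S` rooted `7/10`-separated). [folklore] -/
theorem abs_setIntegral_compl_lennardJones_le {S : Set E3}
    (hS : ∀ p ∈ S, ∀ p' ∈ S, p ≠ p' → (7 : ℝ) / 10 ≤ dist p p') {R : ℝ} (hR : 1 ≤ R) :
    |∫ z in (closedBall (0 : E3) R)ᶜ, lennardJones ‖z‖ ∂(Measure.count.restrict S : Measure E3)| ≤ tailCol R := by
  have h0 : 0 ≤ tailCol R := by
    have : 0 ≤ R⁻¹ := inv_nonneg.2 (by linarith)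
    unfold tailCol; positivity
  rw [← Real.norm_eq_abs]
  refine (norm_integral_le_lintegral_norm _).trans ?_
  simp_rw [ofReal_norm]
  calc (∫⁻ z in (closedBall (0 : E3) R)ᶜ, ‖lennardJones ‖z‖‖ₑ ∂(Measure.count.restrict S : Measure E3)).toReal
      ≤ (ENNReal.ofReal (tailCol R)).toReal :=
        ENNReal.toReal_mono ENNReal.ofReal_ne_top (setLIntegral_enorm_lennardJones_compl_le hS hR)
    _ = tailCol R := ENNReal.toReal_ofReal h0

/-! ## §5. ★ The assembled coherent-window certificate floor -/

/-- ★★★ **T2 — THE COHERENT-WINDOW CERTIFICATE FLOOR (assembly of NODE-9 … NODE-13 with the far columns).**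
Let `S ∋ 0` be `7/10`-separated and COHERENT with the template `a ∋ 0` at tolerance `τ` on the window `B̄(0, Rc)` (`2τ < 7/10 ∧ 2τ <` template
separation, template inside the window), let `I ⊆ a` be the interior sites whose actual atoms `q_x = atomOf S τ x` are in FORCE EQUILIBRIUM
(`hbal`, = `…NashForceBalance.hasSum_force_of_nash` under clause (e)) and at least `7/20` inside the window, and let `y : E3 → E3` be ANY
multipliers.  Then the CERTIFICATE FLOOR — template energy minus the booked debits
 (i) energy slot `τ²·secondNeg |x| + energyRem |x| τ` per bond (NODE-12),
 (ii) `τ·Σ_z ‖ψ(|z|²) z − c_z(y)‖` (NODE-9 residual, Euclidean per site),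
 (iii) the signed host term `Σ_{x∈I} ⟪y_x, H_x⟫`,
 (iv) `Σ_{x∈I} ‖y_x‖·T0(Rc − |x| − τ)` (far force column) and `½·Σ_{x∈a}Σ_{x'∈a∖x} ‖Y_x − Y_{x'}‖·forceRem |x − x'| (dispB x + dispB x')`
 (NODE-10, booked per BOND with the multiplier DIFFERENCE, `Y = mulExt I y`),
 (v) the energy tail `T♯(Rc)` —
is at most `2·rootEnergy V_LJ (count⌊S)`.  Every quantity on the left is an explicit function of the finite data `(a, I, y, τ, Rc)`: this is the
per-cell hypothesis SCHEMA of the atlas (a cell certificate proves `2(ē + γ_cell) ≤ LHS` over its strain box). [folklore] -/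
theorem certFloor_le_two_mul_rootEnergy {S : Set E3} {τ Rc : ℝ} {a I : Finset E3} (y : E3 → E3)
    (hS : ∀ p ∈ S, ∀ p' ∈ S, p ≠ p' → (7 : ℝ) / 10 ≤ dist p p') (h0S : (0 : E3) ∈ S)
    (hτ0 : 0 ≤ τ) (hτ : 2 * τ < 7 / 10) (hRc : 1 ≤ Rc)
    (hcoh : (Measure.count.restrict S : Measure E3) ∈ coherentAt a τ Rc)
    (h0a : (0 : E3) ∈ a) (hIa : I ⊆ a) (ha : ∀ x ∈ a, ∀ x' ∈ a, x ≠ x' → 2 * τ < dist x x')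
    (hin : ∀ x ∈ a, ‖x‖ + τ ≤ Rc) (hI : ∀ x ∈ I, 7 / 20 ≤ Rc - (‖x‖ + τ))
    (hbal : ∀ x ∈ I, HasSum (fun q : {q : E3 // (Measure.count.restrict S : Measure E3) {q} ≠ 0 ∧ q ≠ atomOf S τ x} =>
      ((dist (atomOf S τ x) (q : E3))⁻¹ ^ 8 - (dist (atomOf S τ x) (q : E3))⁻¹ ^ 14) • (atomOf S τ x - (q : E3))) 0) :
    ∑ x ∈ a.erase 0, (phiT (‖x‖ ^ 2) - (τ ^ 2 * secondNeg ‖x‖ + energyRem ‖x‖ τ))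
        - τ * ∑ z ∈ a.erase 0, ‖psiT (‖z‖ ^ 2) • z - certCoeff a I y z‖
        - ∑ x ∈ I, ⟪y x, ∑ x' ∈ a.erase x, ljBondForce (x - x')⟫
        - ∑ x ∈ I, ‖y x‖ * farCol (Rc - (‖x‖ + τ))
        - 1 / 2 * ∑ x ∈ a, ∑ x' ∈ a.erase x, ‖mulExt I y x - mulExt I y x'‖ * forceRem ‖x - x'‖ (dispB τ x + dispB τ x')
        - tailCol Rc
      ≤ 2 * rootEnergy lennardJones (Measure.count.restrict S : Measure E3) := by
  classical
  have h7 : (0 : ℝ) < 7 / 10 := by norm_num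
  have hne : ∀ z ∈ a, (closedBall z τ ∩ S).Nonempty := fun z hz => nonempty_of_mem_coherentAt hcoh hz
  -- the displacement field of the coherent window
  set d : E3 → E3 := fun z => atomOf S τ z - z with hd
  have hq : ∀ z, z + d z = atomOf S τ z := fun z => by
    show z + (atomOf S τ z - z) = atomOf S τ z
    abel
  have hd0 : d 0 = 0 := by
    have h := atomOf_zero hS hτ h0S hτ0
    show atomOf S τ 0 - 0 = 0
    rw [h, sub_zero]
  have hdτ : ∀ z ∈ a, ‖d z‖ ≤ τ := fun z hz => norm_atomOf_sub_le (hne z hz)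
  have hdisp : ∀ z ∈ a, ‖d z‖ ≤ dispB τ z := fun z hz => by
    unfold dispB
    split_ifs with h
    · rw [h, hd0, norm_zero]
    · exact hdτ z hz
  have hdispτ : ∀ z : E3, dispB τ z ≤ τ := fun z => by unfold dispB; split_ifs <;> linarith
  -- (i) energy slots from NODE-12
  have heR : ∀ x ∈ a.erase 0,
      phiT (‖x‖ ^ 2) + psiT (‖x‖ ^ 2) * ⟪x, d x⟫ - (τ ^ 2 * secondNeg ‖x‖ + energyRem ‖x‖ τ) ≤ phiT (‖x + d x‖ ^ 2) := by
    intro x hx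
    obtain ⟨hx0, hxa⟩ := Finset.mem_erase.mp hx
    have hxτ : τ < ‖x‖ := by
      have h := ha x hxa 0 h0a hx0
      rw [dist_zero_right] at h
      linarith
    exact phiT_taylor_ge x (d x) (hdτ x hxa) hxτ
  -- (iv, NODE-10 part) force-remainder slots
  have hfR : ∀ x ∈ I, ∀ x' ∈ a.erase x, ‖ljBondForce ((x + d x) - (x' + d x')) - ljBondForce (x - x') - ljBondForceLin (x - x') (d x - d x')‖
      ≤ forceRem ‖x - x'‖ (dispB τ x + dispB τ x') := by
    intro x hx x' hx'
    obtain ⟨hx'x, hx'a⟩ := Finset.mem_erase.mp hx'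
    have hxa := hIa hx
    have e : (x + d x) - (x' + d x') = (x - x') + (d x - d x') := by abel
    rw [e]
    refine norm_ljBondForce_taylor_le (x - x') (d x - d x') ((norm_sub_le _ _).trans (add_le_add (hdisp x hxa) (hdisp x' hx'a))) ?_
    have h3 := ha x hxa x' hx'a (Ne.symm hx'x)
    rw [dist_eq_norm] at h3
    linarith [hdispτ x, hdispτ x']
  -- (iv, far part) the force balance split
  have hC : ∀ x ∈ I, ‖∑ x' ∈ a.erase x, ljBondForce ((x + d x) - (x' + d x'))‖ ≤ farCol (Rc - (‖x‖ + τ)) := by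
    intro x hx
    simp_rw [hq]
    exact norm_sum_template_force_le hS hτ hcoh ha hin (hIa hx) (hI x hx) (hbal x hx)
  have hcore := windowSum_ge a I y d τ (fun x => τ ^ 2 * secondNeg ‖x‖ + energyRem ‖x‖ τ)
    (fun x x' => forceRem ‖x - x'‖ (dispB τ x + dispB τ x')) (fun x => farCol (Rc - (‖x‖ + τ))) hIa hd0 hdτ heR hfR
    (fun x x' => by rw [norm_sub_rev, add_comm (dispB τ x)]) hC
  beta_reduce at hcore
  -- the energy side: window = template sum (NODE-13), tail ≥ −T♯(Rc)
  have hint := integrable_lennardJones_of_isRootedHardCore h7 ⟨S, h0S, hS, rfl⟩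
  have hwin : ∫ z in closedBall (0 : E3) Rc, lennardJones ‖z‖ ∂(Measure.count.restrict S : Measure E3) =
      ∑ x ∈ a.erase 0, phiT (‖x + d x‖ ^ 2) := by
    rw [setIntegral_closedBall_eq_sum_atomOf hS hτ hcoh hin ha (fun z => lennardJones ‖z‖)]
    beta_reduce
    rw [← Finset.sum_erase_add a _ h0a, atomOf_zero hS hτ h0S hτ0, norm_zero]
    have hV0 : lennardJones 0 = 0 := by unfold lennardJones; simp
    rw [hV0, add_zero]
    exact Finset.sum_congr rfl fun x _ => by rw [lennardJones_eq_phiT, hq]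
  have htail := (abs_le.mp (abs_setIntegral_compl_lennardJones_le hS hRc)).1
  have hE : 2 * rootEnergy lennardJones (Measure.count.restrict S : Measure E3) =
      (∫ z in closedBall (0 : E3) Rc, lennardJones ‖z‖ ∂(Measure.count.restrict S : Measure E3)) +
        ∫ z in (closedBall (0 : E3) Rc)ᶜ, lennardJones ‖z‖ ∂(Measure.count.restrict S : Measure E3) := by
    rw [rootEnergy_def, integral_add_compl measurableSet_closedBall hint]
    ring
  rw [hE, hwin]
  linarith

/-- ★ THE CERTIFICATE FLOOR of the cell data `(a, I, y, τ, Rc)`: the left-hand side of `certFloor_le_two_mul_rootEnergy` — an explicit real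
number computed from finitely many template quantities (the per-cell hypothesis schema of the atlas). -/
def certFloor (a I : Finset E3) (y : E3 → E3) (τ Rc : ℝ) : ℝ :=
  ∑ x ∈ a.erase 0, (phiT (‖x‖ ^ 2) - (τ ^ 2 * secondNeg ‖x‖ + energyRem ‖x‖ τ))
    - τ * ∑ z ∈ a.erase 0, ‖psiT (‖z‖ ^ 2) • z - certCoeff a I y z‖
    - ∑ x ∈ I, ⟪y x, ∑ x' ∈ a.erase x, ljBondForce (x - x')⟫
    - ∑ x ∈ I, ‖y x‖ * farCol (Rc - (‖x‖ + τ))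
    - 1 / 2 * ∑ x ∈ a, ∑ x' ∈ a.erase x, ‖mulExt I y x - mulExt I y x'‖ * forceRem ‖x - x'‖ (dispB τ x + dispB τ x')
    - tailCol Rc

/-- ★★★ **T2 under the crux's own clauses.**  For a rooted `7/10`-hard-core `μ` (clause (a) after `…HardCoreUpgrade`) satisfying the NASH
clause (e) of `AperiodicFrustratedLawGap` verbatim, coherent with the template `a ∋ 0` (tolerance `τ`, window `Rc ≥ 1`, interior `I ⊆ a` at least
`7/20` inside), and ANY multipliers `y`: `certFloor a I y τ Rc ≤ 2·rootEnergy V_LJ μ`. [folklore] -/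
theorem certFloor_le_two_mul_rootEnergy_of_nash {μ : Measure E3} {τ Rc : ℝ} {a I : Finset E3} (y : E3 → E3)
    (hμ : IsRootedHardCore (7 / 10) μ)
    (hNash : ∀ p : E3, μ {p} ≠ 0 → ∀ w : E3, (∀ q : E3, μ {q} ≠ 0 → q ≠ p → w ≠ q) →
      ∑' q : {q : E3 // μ {q} ≠ 0 ∧ q ≠ p}, lennardJones (dist p (q : E3)) ≤
        ∑' q : {q : E3 // μ {q} ≠ 0 ∧ q ≠ p}, lennardJones (dist w (q : E3)))
    (hτ0 : 0 ≤ τ) (hτ : 2 * τ < 7 / 10) (hRc : 1 ≤ Rc) (hcoh : μ ∈ coherentAt a τ Rc)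
    (h0a : (0 : E3) ∈ a) (hIa : I ⊆ a) (ha : ∀ x ∈ a, ∀ x' ∈ a, x ≠ x' → 2 * τ < dist x x')
    (hin : ∀ x ∈ a, ‖x‖ + τ ≤ Rc) (hI : ∀ x ∈ I, 7 / 20 ≤ Rc - (‖x‖ + τ)) :
    certFloor a I y τ Rc ≤ 2 * rootEnergy lennardJones μ := by
  obtain ⟨S, h0S, hS, rfl⟩ := hμ
  have hne : ∀ z ∈ a, (closedBall z τ ∩ S).Nonempty := fun z hz => nonempty_of_mem_coherentAt hcoh hz
  refine certFloor_le_two_mul_rootEnergy y hS h0S hτ0 hτ hRc hcoh h0a hIa ha hin hI fun x hx => ?_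
  have hp : (Measure.count.restrict S : Measure E3) {atomOf S τ x} ≠ 0 :=
    (count_restrict_singleton_ne_zero_iff S _).mpr (atomOf_mem (hne x (hIa hx))).2
  exact hasSum_force_of_nash (by norm_num : (0 : ℝ) < 7 / 10) ⟨S, h0S, hS, rfl⟩ hp (hNash _ hp)

/-- Orientation: the energy tail column at the class-A dial `Rc = 14` is below `9/5000`. [folklore] -/
theorem tailCol_fourteen_le : tailCol 14 ≤ 9 / 5000 := by
  unfold tailCol; norm_num

end Summit.AtomisticToContinuum.Crystallization.Theorems.FrustratedLawDichotomyCoherentFloor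

end
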